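import Mathlib.GroupTheory.Commutator.Basic
import Mathlib.GroupTheory.Abelianization.Defs
import Mathlib.GroupTheory.Index
import Mathlib.LinearAlgebra.Dimension.StrongRankCondition
import Mathlib.LinearAlgebra.FreeModule.Finite.Basic
import Mathlib.LinearAlgebra.FreeModule.StrongRankCondition
import HarnessLib

/-!
# A finite-index subgroup whose normaliser acts trivially on its abelianisation: the rank engine

Topic `Literature/GroupTheory/CombinatorialGroupTheory`; THEOREMS ONLY (no definition, no named fact).

The homological form of "a nontrivial deck transformation of a finite unramified covering of
hyperbolic surfaces acts nontrivially on `H₁(·, ℤ)`", abstract part.  For `H ≤ Γ` of finite index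
and `γ ∈ N_Γ(H) ∖ H` acting TRIVIALLY on `H^{ab} = H/[H,H]` (`γ h γ⁻¹ h⁻¹ ∈ [H, H]` for all `h ∈ H`),
put `L := H·⟨γ⟩`.  Then `L/[H,H]` is generated by the central subgroup `H/[H,H]` and one further
element commuting with it, so it is abelian: `[L, L] = [H, H]`
(`commutator_le_commutator_of_sup_zpowers_eq_top` — transfer-free), `H^{ab} ↪ L^{ab}`
(`abelianizationMap_subtype_injective`) and `rank_ℤ H^{ab} ≤ rank_ℤ L^{ab}`
(`finrank_abelianization_le_of_commutator_le`).  If the rank of the abelianisation of every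
finite-index `K ≤ Γ` is an affine function `[Γ : K]·c + d` of the index with `c ≥ 1`, this
contradicts `[Γ : H] = [L : H]·[Γ : L]`, `[L : H] ≥ 2`: the RANK ENGINE
`exists_conj_not_mem_commutator_of_rank_formula` (+ transport along `≃*`,
`rank_formula_of_mulEquiv`).  The instances — free groups of rank `≥ 2` (Schreier's formula,
Lyndon–Schupp I.3.9), closed surface groups `S_g` (Zieschang–Vogt–Coldewey 4.14.23 + Hurewicz),
hyperbolic `Γ_{g,r}`, and detection of the moved class by characters `H → ℤ/p^e` — are in
`SurfaceGroupAbelianizationFaithful.lean`.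

References: R. C. Lyndon, P. E. Schupp, *Combinatorial Group Theory*, Springer (2001), Ch. I
Prop. 3.9 [LyndonSchupp2001].
-/

noncomputable section

open scoped Classical

namespace Literature.GroupTheory.CombinatorialGroupTheory

universe u

/-! ### A normal subgroup with cyclic quotient acting trivially on its abelianisation -/

section Cyclic

variable {G : Type u} [Group G]

/-- If `H ⊴ G`, `G = H·⟨γ⟩`, and `γ` acts trivially on `H^{ab}` (`γ h γ⁻¹ h⁻¹ ∈ [H, H]` for all
`h ∈ H`), then `[G, G] = [H, H]`: the quotient `G/[H,H]` is generated by the central image of `H` and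
the image of `γ`, hence abelian. [cite: LyndonSchupp2001, Ch. I Prop. 3.9] -/
theorem commutator_le_commutator_of_sup_zpowers_eq_top (H : Subgroup G) [H.Normal] (γ : G)
    (hG : H ⊔ Subgroup.zpowers γ = ⊤) (hγ : ∀ h ∈ H, γ * h * γ⁻¹ * h⁻¹ ∈ ⁅H, H⁆) :
    commutator G ≤ ⁅H, H⁆ := by
  set K : Subgroup G := ⁅H, H⁆ with hK
  let π : G →* G ⧸ K := QuotientGroup.mk' K
  -- images of elements with commutator in `K` commute
  have hcomm : ∀ x y : G, x * y * x⁻¹ * y⁻¹ ∈ K → π x * π y = π y * π x := by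
    intro x y hxy
    have h1 : π (x * y * x⁻¹ * y⁻¹) = 1 := (QuotientGroup.eq_one_iff _).mpr hxy
    rw [map_mul, map_mul, map_mul, map_inv, map_inv, mul_inv_eq_one] at h1
    exact mul_inv_eq_iff_eq_mul.mp h1
  have htop : H.map π ⊔ Subgroup.zpowers (π γ) = ⊤ := by
    rw [← MonoidHom.map_zpowers, ← Subgroup.map_sup, hG,
      Subgroup.map_top_of_surjective _ (QuotientGroup.mk'_surjective K)]
  -- the centre of `G ⧸ K` contains the images of `H` and of `γ`
  have hcenH : ∀ h ∈ H, π h ∈ Subgroup.center (G ⧸ K) := by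
    intro h hh
    have hle : H.map π ⊔ Subgroup.zpowers (π γ) ≤ Subgroup.centralizer {π h} := by
      rw [sup_le_iff, Subgroup.zpowers_le, Subgroup.mem_centralizer_iff]
      refine ⟨?_, ?_⟩
      · rintro _ ⟨h', hh', rfl⟩
        rw [Subgroup.mem_centralizer_iff]
        rintro _ rfl
        exact hcomm h h' (by
          have := Subgroup.commutator_mem_commutator hh hh'
          rwa [commutatorElement_def] at this)
      · rintro _ rfl
        exact (hcomm γ h (hγ h hh)).symm
    rw [htop] at hle
    rw [Subgroup.mem_center_iff]
    intro q
    have hq := Subgroup.mem_centralizer_iff.mp (hle (Subgroup.mem_top q)) (π h) rfl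
    exact hq.symm
  have hcenγ : π γ ∈ Subgroup.center (G ⧸ K) := by
    have hle : H.map π ⊔ Subgroup.zpowers (π γ) ≤ Subgroup.centralizer {π γ} := by
      rw [sup_le_iff, Subgroup.zpowers_le, Subgroup.mem_centralizer_iff]
      refine ⟨?_, ?_⟩
      · rintro _ ⟨h', hh', rfl⟩
        rw [Subgroup.mem_centralizer_iff]
        rintro _ rfl
        exact hcomm γ h' (hγ h' hh')
      · rintro _ rfl
        rfl
    rw [htop] at hle
    rw [Subgroup.mem_center_iff]
    intro q
    exact (Subgroup.mem_centralizer_iff.mp (hle (Subgroup.mem_top q)) (π γ) rfl).symm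
  have hcen : Subgroup.center (G ⧸ K) = ⊤ := by
    rw [eq_top_iff, ← htop, sup_le_iff, Subgroup.zpowers_le]
    refine ⟨?_, hcenγ⟩
    rintro _ ⟨h, hh, rfl⟩
    exact hcenH h hh
  -- hence `G ⧸ K` is abelian and `[G, G] ≤ K`
  have hab : commutator (G ⧸ K) = ⊥ := (commutator_eq_bot_iff_center_eq_top _).mpr hcen
  have hmap : (commutator G).map π = ⊥ := by
    rw [commutator_def, Subgroup.map_commutator,
      Subgroup.map_top_of_surjective _ (QuotientGroup.mk'_surjective K), ← commutator_def, hab]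
  rw [Subgroup.map_eq_bot_iff, QuotientGroup.ker_mk'] at hmap
  exact hmap

/-- For `x : H`, membership of `x` in the commutator subgroup of `H` is membership of `↑x` in
`⁅H, H⁆ ≤ G`. [cite: LyndonSchupp2001, Ch. I Prop. 3.9] -/
theorem mem_commutator_iff_coe_mem (H : Subgroup G) (x : H) :
    x ∈ commutator H ↔ (x : G) ∈ ⁅H, H⁆ := by
  rw [← Subgroup.map_subtype_commutator]
  constructor
  · exact fun hx => Subgroup.mem_map_of_mem _ hx
  · rintro ⟨y, hy, hyx⟩
    have : y = x := Subtype.ext hyx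
    exact this ▸ hy

/-- If `[G, G] ≤ [H, H]` then `H^{ab} → G^{ab}` is injective.
[cite: LyndonSchupp2001, Ch. I Prop. 3.9] -/
theorem abelianizationMap_subtype_injective (H : Subgroup G) (hK : commutator G ≤ ⁅H, H⁆) :
    Function.Injective (Abelianization.map H.subtype) := by
  rw [injective_iff_map_eq_one]
  intro a ha
  obtain ⟨x, rfl⟩ := QuotientGroup.mk_surjective a
  change Abelianization.map H.subtype (Abelianization.of x) = 1 at ha
  rw [Abelianization.map_of] at ha
  have hx : (x : G) ∈ commutator G := by
    rw [← Abelianization.ker_of]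
    exact ha
  have hx' : x ∈ commutator H := (mem_commutator_iff_coe_mem H x).mpr (hK hx)
  change (Abelianization.of x : Abelianization H) = 1
  rw [← MonoidHom.mem_ker, Abelianization.ker_of]
  exact hx'

/-- If `[G, G] ≤ [H, H]` and `G^{ab}` is a finite `ℤ`-module, then
`rank_ℤ H^{ab} ≤ rank_ℤ G^{ab}`. [cite: LyndonSchupp2001, Ch. I Prop. 3.9] -/
theorem finrank_abelianization_le_of_commutator_le (H : Subgroup G) (hK : commutator G ≤ ⁅H, H⁆)
    [Module.Finite ℤ (Additive (Abelianization G))] :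
    Module.finrank ℤ (Additive (Abelianization H)) ≤
      Module.finrank ℤ (Additive (Abelianization G)) := by
  let f : Additive (Abelianization H) →ₗ[ℤ] Additive (Abelianization G) :=
    (MonoidHom.toAdditive (Abelianization.map H.subtype)).toIntLinearMap
  have hf : Function.Injective f := by
    intro a b hab
    have h := abelianizationMap_subtype_injective H hK
    exact Additive.toMul.injective (h (Additive.ofMul.injective hab))
  exact LinearMap.finrank_le_finrank_of_injective hf

end Cyclic

/-! ### The rank engine -/

section Engine

variable {Γ : Type u} [Group Γ]

/-- Transport of subgroup-commutator membership into a subgroup `L`: for `H ≤ L` and `x ∈ L`,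
`x ∈ ⁅H.subgroupOf L, H.subgroupOf L⁆` iff `↑x ∈ ⁅H, H⁆`.
[cite: LyndonSchupp2001, Ch. I Prop. 3.9] -/
theorem mem_commutator_subgroupOf_iff {H L : Subgroup Γ} (hHL : H ≤ L) (x : L) :
    x ∈ ⁅H.subgroupOf L, H.subgroupOf L⁆ ↔ (x : Γ) ∈ ⁅H, H⁆ := by
  have hmap : (⁅H.subgroupOf L, H.subgroupOf L⁆ : Subgroup L).map L.subtype = ⁅H, H⁆ := by
    rw [Subgroup.map_commutator, Subgroup.map_subgroupOf_eq_of_le hHL]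
  rw [← hmap]
  constructor
  · exact fun hx => Subgroup.mem_map_of_mem _ hx
  · rintro ⟨y, hy, hyx⟩
    have : y = x := Subtype.ext hyx
    exact this ▸ hy

/-- **Rank engine.**  Let `Γ` be a group in which the abelianisation of every finite-index subgroup
`K` is a finite `ℤ`-module of rank `[Γ : K]·c + d` with `c ≥ 1` (free groups of rank `≥ 2`,
surface groups).  Then for `H ≤ Γ` of finite index, NO `γ ∈ N_Γ(H) ∖ H` acts trivially on
`H^{ab}`: some `h ∈ H` has `γ h γ⁻¹ h⁻¹ ∉ ⁅H, H⁆`.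
[cite: LyndonSchupp2001, Ch. I Prop. 3.9] -/
theorem exists_conj_not_mem_commutator_of_rank_formula {c d : ℕ} (hc : 1 ≤ c)
    (hrank : ∀ K : Subgroup Γ, K.FiniteIndex →
      Module.Finite ℤ (Additive (Abelianization K)) ∧
        Module.finrank ℤ (Additive (Abelianization K)) = K.index * c + d)
    (H : Subgroup Γ) [H.FiniteIndex] (γ : Γ) (hγN : γ ∈ Subgroup.normalizer (H : Set Γ)) (hγH : γ ∉ H) :
    ∃ h ∈ H, γ * h * γ⁻¹ * h⁻¹ ∉ ⁅H, H⁆ := by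
  by_contra hall
  simp only [not_exists, not_and, not_not] at hall
  set Z : Subgroup Γ := Subgroup.zpowers γ with hZ
  set L : Subgroup Γ := H ⊔ Z with hL
  have hHL : H ≤ L := le_sup_left
  have hZL : Z ≤ L := le_sup_right
  have hγL : γ ∈ L := hZL (Subgroup.mem_zpowers γ)
  haveI hLfi : L.FiniteIndex := Subgroup.finiteIndex_of_le hHL
  -- `H` is normal in `L`, with cyclic quotient generated by `γ`
  have hLN : L ≤ Subgroup.normalizer (H : Set Γ) :=
    sup_le Subgroup.le_normalizer (Subgroup.zpowers_le.mpr hγN)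
  haveI hHn : (H.subgroupOf L).Normal := (Subgroup.normal_subgroupOf_iff_le_normalizer hHL).mpr hLN
  set γ' : L := ⟨γ, hγL⟩ with hγ'
  have hZ' : Subgroup.zpowers γ' = Z.subgroupOf L := by
    apply le_antisymm
    · rw [Subgroup.zpowers_le, Subgroup.mem_subgroupOf]
      exact Subgroup.mem_zpowers γ
    · intro x hx
      rw [Subgroup.mem_subgroupOf, Subgroup.mem_zpowers_iff] at hx
      obtain ⟨k, hk⟩ := hx
      rw [Subgroup.mem_zpowers_iff]
      exact ⟨k, Subtype.ext (by rw [Subgroup.coe_zpow]; exact hk)⟩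
  have hsup : H.subgroupOf L ⊔ Subgroup.zpowers γ' = ⊤ := by
    rw [hZ', ← Subgroup.subgroupOf_sup hHL hZL]
    change L.subgroupOf L = ⊤
    exact Subgroup.subgroupOf_self (H := L)
  have htriv : ∀ h ∈ H.subgroupOf L,
      γ' * h * γ'⁻¹ * h⁻¹ ∈ ⁅H.subgroupOf L, H.subgroupOf L⁆ := by
    intro h hh
    rw [Subgroup.mem_subgroupOf] at hh
    rw [mem_commutator_subgroupOf_iff hHL]
    exact hall h hh
  have hcomm : commutator L ≤ ⁅H.subgroupOf L, H.subgroupOf L⁆ :=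
    commutator_le_commutator_of_sup_zpowers_eq_top (H.subgroupOf L) γ' hsup htriv
  -- ranks
  obtain ⟨hLfin, hLrank⟩ := hrank L hLfi
  obtain ⟨-, hHrank⟩ := hrank H inferInstance
  haveI := hLfin
  have hle : Module.finrank ℤ (Additive (Abelianization (H.subgroupOf L))) ≤
      Module.finrank ℤ (Additive (Abelianization L)) :=
    finrank_abelianization_le_of_commutator_le (H.subgroupOf L) hcomm
  have heq : Module.finrank ℤ (Additive (Abelianization (H.subgroupOf L))) =
      Module.finrank ℤ (Additive (Abelianization H)) :=
    (MulEquiv.toAdditive (Subgroup.subgroupOfEquivOfLe hHL).abelianizationCongr).toIntLinearEquiv.finrank_eq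
  rw [heq, hHrank, hLrank] at hle
  -- indices: `[Γ : H] = [L : H]·[Γ : L]` with `[L : H] ≥ 2`
  have hidx : H.relIndex L * L.index = H.index := Subgroup.relIndex_mul_index hHL
  have hm1 : H.relIndex L ≠ 1 := by
    rw [Ne, Subgroup.relIndex_eq_one]
    exact fun h => hγH (h hγL)
  have hm0 : H.relIndex L ≠ 0 := by
    intro h0
    rw [h0, zero_mul] at hidx
    exact Subgroup.FiniteIndex.index_ne_zero hidx.symm
  have hpos : 0 < L.index * c :=
    Nat.mul_pos (Nat.pos_of_ne_zero Subgroup.FiniteIndex.index_ne_zero) hc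
  rw [← hidx] at hle
  -- `m · ([Γ:L] c) + d ≤ [Γ:L] c + d` forces `m ≤ 1`
  have h2 : H.relIndex L * (L.index * c) ≤ 1 * (L.index * c) := by
    rw [one_mul, ← mul_assoc]; omega
  have h3 : H.relIndex L ≤ 1 := Nat.le_of_mul_le_mul_right h2 hpos
  omega

/-- Transport of the rank hypothesis along an isomorphism `e : Γ ≃* Γ'`.
[cite: LyndonSchupp2001, Ch. I Prop. 3.9] -/
theorem rank_formula_of_mulEquiv {Γ' : Type u} [Group Γ'] (e : Γ ≃* Γ') {c d : ℕ}
    (hrank : ∀ K : Subgroup Γ', K.FiniteIndex →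
      Module.Finite ℤ (Additive (Abelianization K)) ∧
        Module.finrank ℤ (Additive (Abelianization K)) = K.index * c + d) :
    ∀ K : Subgroup Γ, K.FiniteIndex →
      Module.Finite ℤ (Additive (Abelianization K)) ∧
        Module.finrank ℤ (Additive (Abelianization K)) = K.index * c + d := by
  intro K hK
  set K' : Subgroup Γ' := K.map (e : Γ →* Γ') with hK'
  have hidx : K'.index = K.index := Subgroup.index_map_equiv K e
  haveI : K'.FiniteIndex := ⟨by rw [hidx]; exact hK.index_ne_zero⟩
  obtain ⟨hfin, hrk⟩ := hrank K' inferInstance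
  let L : Additive (Abelianization K) ≃ₗ[ℤ] Additive (Abelianization K') :=
    (MulEquiv.toAdditive (e.subgroupMap K).abelianizationCongr).toIntLinearEquiv
  haveI := hfin
  exact ⟨Module.Finite.equiv L.symm, by rw [L.finrank_eq, hrk, hidx]⟩

end Engine

end Literature.GroupTheory.CombinatorialGroupTheory

end
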